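import Summits.FinalStateConjecture.FinalStateConjecture.Theorems.SettledCapture.Negative.TypedNormalForm
import Literature.Geometry.Lorentzian.KerrStabilitySubextremalCauchy
import Literature.Geometry.Lorentzian.HintzGluedEMRIData
import HarnessLib

/-!
# Sketch for crux-ideate (round 1, ideator 1) on `BartnikGapSettling.SettledCapture`
# (stmt-FinalStateConjecture-17328): first lemmas of the card `kerr-capped-twin`, and the
# kernel form of the typing finding recorded in NOTES.md `## Barrier notes`.

Nothing here asserts a Theses decl. Sorries only in `hintzMarginBasin_of_claim` (the card's
First lemma, to be proved by a crux-plan / prover seat).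
-/

noncomputable section

open Set Filter
open scoped Manifold ContDiff ENNReal Topology

namespace Summit.FinalStateConjecture.FinalStateConjecture.Cruxes.SettledCapture.KerrCappedTwin

open Literature.Geometry.Lorentzian

/-! ## 1. First lemma of `kerr-capped-twin`: the margin makes Hintz's basin uniform in the spin

The vendored claim `hintz_kerr_stability_subextremal_cauchy_allOrders` gives, per normalised
centre `χ₀` and inner radius `ρ₀`, exponents `(s, δ)` and a spin radius `ς`, and per `(M, η)` one
basin radius `ε`. The crux hands over holes with `|aᵢ| ≤ χ Mᵢ`, `χ < 1`: covering the compact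
spin interval `[-χ, χ]` by finitely many claim-balls at the common inner radius
`ρ₀ = 1 + √(1 - χ²)/2 ∈ (1 - √(1 - χ₀²), 1 + √(1 - χ₀²))` yields ONE finite set of orders `S`,
ONE finite set of weights `Δ` and ONE `ε > 0` serving every spin of the margin (at each mass).
Uniformity in `M ∈ [m₀, 1/m₀]` is the scaling covariance of the vacuum equations (not typed here).
-/

/-- **Margin-uniform Hintz basin (one mass).** For `0 ≤ χ < 1`, `M > 0`, `η > 0` there are a
finite set of smallness orders `S`, a finite set of weights `Δ` and one `ε > 0` such that every
vacuum datum on the Kerr–Schild slice `Kerr.slice a (ρ₀ M)`, `ρ₀ = 1 + √(1-χ²)/2`, with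
`|a| ≤ χ M`, b-conormal at every weight of `Δ` and `ε`-close to `Kerr.data M a` at every order of
`S` and weight of `Δ`, has all its MGHDs converging (all orders) to a SUB-EXTREMAL Kerr with
parameters `η`-close, with sojourn-complete far `𝓘⁺`. -/
def HintzMarginBasin [Kerr.Facts] [Kerr.SliceFacts] : Prop :=
  ∀ (χ : ℝ), 0 ≤ χ → χ < 1 → ∀ (M : ℝ) (hM : 0 < M), ∀ η > (0 : ℝ),
    ∃ (S : Finset ℕ) (Δ : Finset ℝ) (ε : ℝ), 0 < ε ∧
      ∀ a : ℝ, |a| ≤ χ * M →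
        ∀ (D : InitialDataSet 𝓘(ℝ, E3) (Kerr.slice a ((1 + √(1 - χ ^ 2) / 2) * M)))
          [D.metric.HasLeviCivita],
          D.IsVacuumConstraintSolution →
          (∀ δ ∈ Δ, ∀ s' : ℕ, InitialDataSet.dataWeightedSobolevEDist s' δ D
              (Kerr.data M a ((1 + √(1 - χ ^ 2) / 2) * M) hM.le) < ⊤) →
          (∀ δ ∈ Δ, ∀ s ∈ S, InitialDataSet.dataWeightedSobolevEDist s δ D
              (Kerr.data M a ((1 + √(1 - χ ^ 2) / 2) * M) hM.le) < ENNReal.ofReal ε) →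
          ∀ 𝒟 : VacuumCauchyDevelopment D, 𝒟.IsMaximal →
            ∃ (M' a' : ℝ) (𝒟oc : Set 𝒟.carrier), Kerr.IsSubextremal M' a' ∧
              |M' - M| + |a' - a| ≤ η ∧ 𝒟.HasCompleteFutureNullInfinityFar ∧
              ∀ k : ℕ, 𝒟.toSpacetime.ConvergesToKerr 𝒟oc M' a' k

/-- **First lemma of the card** (provable now, size M: finite subcover of `[-χ, χ]` by the
claim's spin balls at the common normalised inner radius `1 + √(1 - χ²)/2`; the inner-radius
window `ρ₀ ∈ (1 - √(1-χ₀²), 1 + √(1-χ₀²))` holds for every `|χ₀| ≤ χ` since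
`√(1 - χ₀²) ≥ √(1 - χ²)`). -/
theorem hintzMarginBasin_of_claim [Kerr.Facts] [Kerr.SliceFacts]
    (h : hintz_kerr_stability_subextremal_cauchy_allOrders) : HintzMarginBasin := by
  sorry

/-! ## 2. Typed shape of the capping stub (`ExteriorKerrAnnulusGluing`)

Li–Mei-type gluing (Li–Mei, CMP 378 (2020), Prop. 4.1 — there on the spacelike cylinder
`{r = r₀}` INSIDE the hole; Corvino–Schoen, JDG 73 (2006); Chruściel–Delay, Mém. SMF 94 (2003),
§8) on an EXTERIOR annulus `{R ≤ ‖y‖ ≤ 2R}` of the Kerr–Schild slice: data `ε`-close in `Cᵏ`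
(sup, Cartesian readings) to `Kerr.data M a` on `{‖y‖ ≤ 4R}` are deformed on the annulus into
vacuum data equal to the input on `{‖y‖ ≤ R}` and EXACTLY Kerrian — `Kerr.data M' a'` read
through a rotation `ρ` of the axis — on `{‖y‖ ≥ 2R}`, with `|M' - M| + |a' - a| ≤ C ε` (the
cokernel `{∂_t, ∂_φ}` resp. `{∂_t, Ω₁, Ω₂, Ω₃}` at `a = 0` is absorbed by `(M, a⃗)`). The output
lives on the same carrier `Kerr.slice a r₀` (for `‖y‖ ≥ 2R ≫ r₊` every slice contains `y`).
-/

/-- `Cᵏ` sup-closeness of the Cartesian readings of two data on open subsets of `E3`, on the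
closed ball of radius `b`. [folklore] -/
def ReadingsClose {U V : TopologicalSpace.Opens E3} (D : InitialDataSet 𝓘(ℝ, E3) U)
    (D' : InitialDataSet 𝓘(ℝ, E3) V) (k : ℕ) (b ε : ℝ) : Prop :=
  ∀ y : E3, ‖y‖ ≤ b → ∀ m : ℕ, m ≤ k →
    ‖iteratedFDeriv ℝ m (fun z ↦ D.coordHOn z - D'.coordHOn z) y‖ ≤ ε ∧
    ‖iteratedFDeriv ℝ m (fun z ↦ D.coordKOn z - D'.coordKOn z) y‖ ≤ ε

/-- Readings of a datum agree with the readings of another datum precomposed with a linear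
isometry `ρ` of `E3` (rotation of the spin axis) at the point `y`. [folklore] -/
def SameReadingUpTo {U V : TopologicalSpace.Opens E3} (D : InitialDataSet 𝓘(ℝ, E3) U)
    (D' : InitialDataSet 𝓘(ℝ, E3) V) (ρ : E3 →L[ℝ] E3) (y : E3) : Prop :=
  D.coordHOn y = (D'.coordHOn (ρ y)).bilinearComp ρ ρ ∧
    D.coordKOn y = (D'.coordKOn (ρ y)).bilinearComp ρ ρ

/-- **Exterior Kerr annulus gluing** (typed shape of stub S1 of `kerr-capped-twin`). -/
def ExteriorKerrAnnulusGluing [Kerr.Facts] [Kerr.SliceFacts] : Prop :=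
  ∀ (χ : ℝ), 0 ≤ χ → χ < 1 → ∀ (M : ℝ) (hM : 0 < M),
    ∃ R₀ : ℝ, 0 < R₀ ∧ ∀ R : ℝ, R₀ ≤ R →
      ∃ (k : ℕ) (ε₀ C : ℝ), 0 < ε₀ ∧ 0 ≤ C ∧
        ∀ (a : ℝ), |a| ≤ χ * M → ∀ (ε : ℝ), 0 < ε → ε ≤ ε₀ →
          letI r₀ : ℝ := (1 + √(1 - χ ^ 2) / 2) * M
          ∀ (D : InitialDataSet 𝓘(ℝ, E3) (Kerr.slice a r₀)) [D.metric.HasLeviCivita],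
            (∀ y : Kerr.slice a r₀, ‖(y : E3)‖ < 4 * R →
              D.hamiltonianConstraintFn y = 0 ∧ D.momentumConstraintFn y = 0) →
            ReadingsClose D (Kerr.data M a r₀ hM.le) k (4 * R) ε →
            ∃ (M' a' : ℝ) (hM' : 0 < M') (ρ : E3 ≃ₗᵢ[ℝ] E3)
              (D' : InitialDataSet 𝓘(ℝ, E3) (Kerr.slice a r₀)) (_ : D'.metric.HasLeviCivita),
              |M' - M| + |a' - a| ≤ C * ε ∧ ‖(ρ : E3 →L[ℝ] E3) - ContinuousLinearMap.id ℝ E3‖ ≤ C * ε / (|a| + ε) ∧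
              D'.IsVacuumConstraintSolution ∧
              (∀ y : E3, ‖y‖ ≤ R → D'.coordHOn y = D.coordHOn y ∧ D'.coordKOn y = D.coordKOn y) ∧
              (∀ y : E3, 2 * R ≤ ‖y‖ →
                SameReadingUpTo D' (Kerr.data M' a' r₀ hM'.le) (ρ : E3 →L[ℝ] E3) y) ∧
              ReadingsClose D' (Kerr.data M a r₀ hM.le) k (4 * R) (C * ε)

/-! ## 3. Kernel form of the typing finding (NOTES.md `## Barrier notes`, B1)

Modulo the DODGE principle (the typed leaf hypothesis is idle: Negative/TypedNormalForm), ONE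
admissible datum with ONE complete-`𝓘⁺` MGHD failing the T2 conclusion refutes the crux as typed.
B1 proposes the witness: EXTREMAL-Kerr-SHIELDED data (exactly extremal Kerr outside a compact set
hidden in `{r < M}`), whose MGHD has the exact extremal Kerr domain of outer communications — no
dynamics (no Kehle–Unger formation) needed; the conclusion fails there by Kerr parameter rigidity +
the entire-slab crossing lemma (B2). The implication itself is pure logic over the landed lemma. -/

open Summit.FinalStateConjecture.FinalStateConjecture.Theorems.SettledCapture.Negative in
/-- One bad complete-`𝓘⁺` MGHD of an admissible datum refutes the typed crux, given the dodge
principle `hDP`. [folklore] -/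
theorem not_settledCapture_of_dodge_of_witness
    (hDP : ∀ (X : Type) [TopologicalSpace X] [ChartedSpace E3 X] [IsManifold (𝓡 3) ∞ X] [T2Space X]
      [SecondCountableTopology X] [ConnectedSpace X], ∀ D ∈ admissibleVacuumData X,
      ∀ 𝒟 : VacuumCauchyDevelopment D, 𝒟.IsMaximal →
        Summit.FinalStateConjecture.HasCompleteNullInfinity 𝒟.toCauchyDevelopment → LeafHyp 𝒟)
    (hW : ∃ (X : Type) (_ : TopologicalSpace X) (_ : ChartedSpace E3 X) (_ : IsManifold (𝓡 3) ∞ X)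
      (_ : T2Space X) (_ : SecondCountableTopology X) (_ : ConnectedSpace X)
      (D : InitialDataSet (𝓡 3) X) (_ : D ∈ admissibleVacuumData X)
      (𝒟 : VacuumCauchyDevelopment D), 𝒟.IsMaximal ∧
        Summit.FinalStateConjecture.HasCompleteNullInfinity 𝒟.toCauchyDevelopment ∧
        ¬ T2Conclusion 𝒟) :
    ¬ Theses.BartnikGapSettling.SettledCapture := by
  refine not_settledCapture_of_dodge_of_not_nonGenericSettlingT2 hDP ?_
  intro hall
  obtain ⟨X, _, _, _, _, _, _, D, hD, 𝒟, hmax, hscri, hbad⟩ := hW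
  exact hbad (hall X D hD 𝒟 hmax hscri)

end Summit.FinalStateConjecture.FinalStateConjecture.Cruxes.SettledCapture.KerrCappedTwin

end
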